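import Literature.Analysis.FluidPDE.NavierStokesConcentrationCorrectorProofs
import Literature.Analysis.FunctionSpaces.TorusInverseLaplacianCalculus
import HarnessLib

/-!
# Local classical solutions of the forced Navier–Stokes system on `T^d` from the zero datum

Analysis/FluidPDE proof file (theorems only; no definitions, no named facts).  For a viscosity `ν > 0`
and a smooth, mean-zero, steady body force `f : T^d → ℝ^d` the forced incompressible Navier–Stokes system
`∂ₜu + (u·∇)u = νΔu − ∇p + f`, `div u = 0` has a classical solution `(u, p)` on a short closed time
interval `[0, T] × T^d` with `u(0) = 0` and mean-zero velocity and pressure slices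
(`Torus.exists_classicalNS_forced_zero_datum`).  This is the short-time smooth theory
(Majda–Bertozzi 2002, Thm. 3.4, which is stated with a force `F ∈ C¹_c([0,∞); V^m)`; Robinson–Rodrigo–Sadowski
2016, Thm. 6.8) in the elementary case needed to ANCHOR continuation arguments for the forced system on the
torus (`TorusClassicalNSContinuation`, `TorusNSVDataExistence` take a background solution of NS_ν(f) as
input; this file produces one from nothing).

THE ARGUMENT.  (1) A smooth mean-zero field is a tensor divergence: `g = div R` with the smooth columns
`R(·) j = ∂ⱼ Δ⁻¹ g` (`Torus.laplacian_invLaplacian_of_completeSpace`; `Torus.exists_isSmooth_tensorDivergence_eq`).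
(2) At unit viscosity the tree's Fourier–Picard construction for the stress-forced perturbation system of
Cheskidov–Luo (`CorrectorFourier.isLinearizedNSSolutionOn_vel`: `∂ₜv + (v·∇)v + (U·∇)v + (v·∇)U + ∇q = Δv − div R`,
`v(0) = 0`, zero means, on `[0, θ]` below the threshold `CorrectorFourier.exists_threshold`) with the ZERO
background `U = 0` and the steady stress of (1) for `g = −f` is exactly NS₁(f) from the zero datum
(`Torus.exists_classicalNS_forced_zero_datum_one`).  (3) The parabolic rescaling
`(u, p)(t, x) = (ν v(νt, x), ν² q(νt, x))` maps classical solutions of NS₁(f₁) on `[0, θ]` to classical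
solutions of NS_ν(ν² f₁) on `[0, θ/ν]` (`Torus.IsClassicalNSSolutionOn.viscosity_rescale_Icc`); with
`f₁ = ν⁻² f` this is NS_ν(f).
Deliberately NOT here: nonzero data (`TorusPerturbedNSLocalExistence`, `TorusClassicalNSContinuation`),
uniqueness, continuation.

## Tree search

`lean search 'exists_classicalNS|forced_zero|IsClassicalNSSolutionOn.*rescale'`: unforced smooth-data existence
`Torus.exists_classicalNS_smooth` (`TorusNSSmoothLocalExistence`), forced continuation near a GIVEN background
(`….exists_forced_solution_of_gradNormSq_le`), whole-space rescalings (`ClassicalSolutionRescale`), the torus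
rescaling on `univ` of the summit file `Negative/Scaling`; no forced existence without a background.

## References

* A. J. Majda, A. L. Bertozzi, *Vorticity and Incompressible Flow*, CUP 2002, Thm. 3.4. [MajdaBertozziCUP2002]
* A. Cheskidov, X. Luo, *Sharp nonuniqueness for the Navier–Stokes equations*, Invent. Math. 229 (2022),
  §3.1 (3.2). [CheskidovLuo2022]
* J. C. Robinson, J. L. Rodrigo, W. Sadowski, *The Three-Dimensional Navier–Stokes Equations*, CUP 2016,
  Thm. 6.8. [RobinsonRodrigoSadowskiCUP2016]
-/

noncomputable section

open MeasureTheory Set Function Filter UnitAddTorus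
open scoped ContDiff InnerProductSpace Topology

namespace Literature.Analysis.FluidPDE

open Literature.Analysis.FunctionSpaces
open CorrectorFourier ScalarFourier
open FourierNS (HasDecay)

variable {d : Type*} [Fintype d] [DecidableEq d]

/-! ### Smooth mean-zero fields are tensor divergences -/

/-- **A smooth mean-zero vector field on `T^d` is the divergence of a smooth tensor field**: with
`G = Δ⁻¹ g` and the columns `R(·) j = ∂ⱼ G` one has `div R = ∑ⱼ ∂ⱼ∂ⱼ G = ΔΔ⁻¹ g = g − ∫ g = g`
(Cheskidov–Luo 2022, §7.2, the inverse Laplacian on `C^∞(T^d)`). [folklore] -/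
theorem Torus.exists_isSmooth_tensorDivergence_eq [Nonempty d] {g : UnitAddTorus d → EuclideanSpace ℝ d}
    (hg : Torus.IsSmooth g) (hgm : Torus.HasZeroMean g) :
    ∃ R : UnitAddTorus d → d → EuclideanSpace ℝ d, Torus.IsSmooth R ∧ ∀ x, tensorDivergence R x = g x := by
  have hG : Torus.IsSmooth (Torus.invLaplacian g) := Torus.isSmooth_invLaplacian hg
  refine ⟨fun y j => Torus.partialDeriv j (Torus.invLaplacian g) y, ?_, fun x => ?_⟩
  · exact contDiff_pi.2 fun j => hG.partialDeriv j
  · show ∑ j, Torus.partialDeriv j (fun y => Torus.partialDeriv j (Torus.invLaplacian g) y) x = g x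
    rw [← Torus.laplacian_eq_sum_partialDeriv_partialDeriv hG, Torus.laplacian_invLaplacian_of_completeSpace hg]
    rw [show ∫ y, g y = 0 from hgm, sub_zero]

/-! ### Unit viscosity: the stress-forced perturbation system around the zero background -/

/-- **Forced Navier–Stokes at unit viscosity from the zero datum.**  For a smooth mean-zero steady force
`f` on `T^d` there are `θ > 0` and a classical solution `(v, q)` of NS₁(f) on `[0, θ] × T^d` with `v(0) = 0`
and mean-zero slices of `v` and `q`: the Fourier–Picard solution of the stress-forced perturbation system
(Cheskidov–Luo 2022, (3.2)) around the zero background with the steady stress `R`, `div R = −f`.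
[cite: MajdaBertozziCUP2002, Thm. 3.4] -/
theorem Torus.exists_classicalNS_forced_zero_datum_one [Nonempty d] {f : UnitAddTorus d → EuclideanSpace ℝ d}
    (hf : Torus.IsSmooth f) (hfm : Torus.HasZeroMean f) :
    ∃ θ : ℝ, 0 < θ ∧ ∃ (v : ℝ → UnitAddTorus d → EuclideanSpace ℝ d) (q : ℝ → UnitAddTorus d → ℝ),
      Torus.IsClassicalNSSolutionOn (Icc 0 θ) 1 (fun _ => f) v q ∧ v 0 = 0 ∧
      (∀ t ∈ Icc 0 θ, Torus.HasZeroMean (v t)) ∧ ∀ t ∈ Icc 0 θ, Torus.HasZeroMean (q t) := by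
  -- the steady stress with `div R₀ = -f`
  have hnf : Torus.IsSmooth (fun x => -f x) := hf.neg
  have hnfm : Torus.HasZeroMean (fun x => -f x) := by
    show ∫ x, -f x = 0
    rw [integral_neg, show ∫ x, f x = 0 from hfm, neg_zero]
  obtain ⟨R₀, hR₀, hdiv₀⟩ := Torus.exists_isSmooth_tensorDivergence_eq hnf hnfm
  set U : ℝ → UnitAddTorus d → EuclideanSpace ℝ d := fun _ _ => 0 with hUdef
  set R : ℝ → UnitAddTorus d → d → EuclideanSpace ℝ d := fun _ => R₀ with hRdef
  have hU0 : Torus.IsSmooth (fun _ : UnitAddTorus d => (0 : EuclideanSpace ℝ d)) := contDiff_const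
  have hU : Torus.IsSmoothSpaceTimeOn (Icc 0 1) U := Torus.isSmoothSpaceTimeOn_const hU0 _
  have hR : Torus.IsSmoothSpaceTimeOn (Icc 0 1) R := Torus.isSmoothSpaceTimeOn_const hR₀ _
  have hUdiv : ∀ t ∈ Icc (0 : ℝ) 1, Torus.IsDivFree (U t) := fun t _ x => by
    show Torus.divergence (fun _ : UnitAddTorus d => (0 : EuclideanSpace ℝ d)) x = 0
    unfold Torus.divergence Torus.partialDeriv Torus.lineDeriv
    simp
  -- global coefficient bounds of the background and the stress at order `2#d + 1` on `[0, 1]`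
  have hAj : ∀ j : d, ∃ C : ℝ, 0 ≤ C ∧ ∀ t ∈ Icc (0 : ℝ) 1,
      HasDecay (latOrder d + 1) C (fun k => mFourierCoeff (compC U j t) k) := fun j =>
    exists_hasDecay_mFourierCoeff_spaceTime one_pos (isSmoothSpaceTimeOn_compC hU j) _
  choose Aj hAj0 hAj using hAj
  have hBq : ∀ q : d × d, ∃ C : ℝ, 0 ≤ C ∧ ∀ t ∈ Icc (0 : ℝ) 1,
      HasDecay (latOrder d + 1) C (fun k => mFourierCoeff (entryC R q.1 q.2 t) k) := fun q =>
    exists_hasDecay_mFourierCoeff_spaceTime one_pos (isSmoothSpaceTimeOn_entryC hR q.1 q.2) _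
  choose Bq hBq0 hBq using hBq
  set A : ℝ := ∑ j, Aj j with hAdef
  set B : ℝ := ∑ q, Bq q with hBdef
  have hA0 : 0 ≤ A := Finset.sum_nonneg fun j _ => hAj0 j
  have hB0 : 0 ≤ B := Finset.sum_nonneg fun q _ => hBq0 q
  have hAall : ∀ t ∈ Icc (0 : ℝ) 1, ∀ j, HasDecay (latOrder d + 1) A (fun k => mFourierCoeff (compC U j t) k) :=
    fun t ht j => (hAj j t ht).mono (Finset.single_le_sum (fun i _ => hAj0 i) (Finset.mem_univ j))
  have hBall : ∀ t ∈ Icc (0 : ℝ) 1, ∀ l j, HasDecay (latOrder d + 1) B (fun k => mFourierCoeff (entryC R l j t) k) :=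
    fun t ht l j => (hBq (l, j) t ht).mono (Finset.single_le_sum (fun q _ => hBq0 q) (Finset.mem_univ (l, j)))
  -- the threshold (radius `1`)
  obtain ⟨θ, hθ, hθ1, hthr⟩ := CorrectorFourier.exists_threshold (d := d) one_pos hA0 hB0
  obtain ⟨hS1, hS2⟩ := hthr θ hθ le_rfl
  have hsub : Icc (0 : ℝ) θ ⊆ Icc 0 1 := Icc_subset_Icc_right hθ1
  have hUθ : Torus.IsSmoothSpaceTimeOn (Icc 0 θ) U := hU.mono hsub
  have hRθ : Torus.IsSmoothSpaceTimeOn (Icc 0 θ) R := hR.mono hsub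
  have hUdivθ : ∀ t ∈ Icc (0 : ℝ) θ, Torus.IsDivFree (U t) := fun t ht => hUdiv t (hsub ht)
  have hUA : ∀ j t, HasDecay (latOrder d + 1) A (driftCoeff θ U j t) :=
    hasDecay_driftCoeff_of_forall hθ.le fun s hs j => hAall s (hsub hs) j
  have hRB : ∀ l j t, HasDecay (latOrder d + 1) B (stressCoeff θ R l j t) :=
    hasDecay_stressCoeff_of_forall hθ.le fun s hs l j => hBall s (hsub hs) l j
  obtain ⟨hsol, -⟩ :=
    CorrectorFourier.isLinearizedNSSolutionOn_vel hθ hθ1 hUθ hUdivθ hRθ zero_le_one hA0 hB0 hUA hRB hS1 hS2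
  refine ⟨θ, hθ, vel θ U R, pres θ U R, ⟨hsol.smooth_v, hsol.smooth_q, fun t ht x => ?_, hsol.divFree⟩,
    funext hsol.initial, hsol.hasZeroMean_v, hsol.hasZeroMean_q⟩
  -- the momentum equation: the background terms vanish and `-div R₀ = f`
  have hm := hsol.momentum t ht x
  have h1 : Torus.convect (U t) (vel θ U R t) x = 0 := by
    simp only [hUdef, Torus.convect, map_zero]
  have h2 : Torus.convect (vel θ U R t) (U t) x = 0 := Torus.convect_zero_right _ x
  rw [h1, h2, add_zero, add_zero] at hm
  rw [one_smul, eq_sub_of_add_eq hm, hRdef]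
  dsimp only
  rw [hdiv₀ x]
  abel

/-! ### Parabolic rescaling on a closed interval -/

/-- **Parabolic rescaling of classical solutions on a closed time interval**: if `(v, q)` is a classical
solution of NS_μ(f₁) (steady force) on `[0, θ] × T^d` and `a > 0`, then
`(u, p)(t, x) = (a v(at, x), a² q(at, x))` is a classical solution of NS_{aμ}(a² f₁) on `[0, θ/a] × T^d`:
joint smoothness composes with `(t, y) ↦ (at, y)`, the one-sided time derivative within `[0, θ/a]` is the
chain rule (`HasDerivWithinAt.scomp`, `s ↦ as` maps `[0, θ/a]` onto `[0, θ]`), and every term of the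
momentum equation scales by `a²`. [folklore] -/
theorem _root_.Literature.Analysis.FunctionSpaces.Torus.IsClassicalNSSolutionOn.viscosity_rescale_Icc {μ θ a : ℝ}
    {f₁ : UnitAddTorus d → EuclideanSpace ℝ d} {v : ℝ → UnitAddTorus d → EuclideanSpace ℝ d}
    {q : ℝ → UnitAddTorus d → ℝ} (h : Torus.IsClassicalNSSolutionOn (Icc 0 θ) μ (fun _ => f₁) v q)
    (ha : 0 < a) (hθ : 0 < θ) :
    Torus.IsClassicalNSSolutionOn (Icc 0 (θ / a)) (a * μ) (fun _ => a ^ 2 • f₁) (fun t x => a • v (a * t) x)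
      fun t x => a ^ 2 * q (a * t) x := by
  have hmaps : MapsTo (fun t : ℝ => a * t) (Icc 0 (θ / a)) (Icc 0 θ) := fun t ht =>
    ⟨mul_nonneg ha.le ht.1, by rw [← mul_div_cancel₀ θ ha.ne']; exact mul_le_mul_of_nonneg_left ht.2 ha.le⟩
  have hφ : ContDiff ℝ ((⊤ : ℕ∞) : WithTop ℕ∞)
      (fun z : ℝ × EuclideanSpace ℝ d => ((a * z.1, z.2) : ℝ × EuclideanSpace ℝ d)) :=
    (contDiff_const.mul contDiff_fst).prodMk contDiff_snd
  have hφmaps : MapsTo (fun z : ℝ × EuclideanSpace ℝ d => ((a * z.1, z.2) : ℝ × EuclideanSpace ℝ d))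
      (Icc 0 (θ / a) ×ˢ univ) (Icc 0 θ ×ˢ univ) := fun z hz =>
    mk_mem_prod (hmaps (mem_prod.1 hz).1) (mem_univ _)
  have hθa : 0 < θ / a := div_pos hθ ha
  have hUD : UniqueDiffOn ℝ (Icc 0 (θ / a)) := uniqueDiffOn_Icc hθa
  refine ⟨?_, ?_, fun t ht x => ?_, fun t ht x => ?_⟩
  · have h1 : Torus.IsSmoothSpaceTimeOn (Icc 0 (θ / a)) (fun t x => v (a * t) x) :=
      h.smooth_velocity.comp hφ.contDiffOn hφmaps
    exact h1.const_smul a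
  · have h1 : Torus.IsSmoothSpaceTimeOn (Icc 0 (θ / a)) (fun t x => q (a * t) x) :=
      h.smooth_pressure.comp hφ.contDiffOn hφmaps
    have h2 := h1.const_smul (a ^ 2)
    simpa only [smul_eq_mul] using h2
  · have hat : a * t ∈ Icc 0 θ := hmaps ht
    have hvs : Torus.IsSmooth (v (a * t)) := h.smooth_velocity.isSmooth_slice hat
    have hqs : Torus.IsSmooth (q (a * t)) := h.smooth_pressure.isSmooth_slice hat
    have h1 : Torus.timeDerivWithin (Icc 0 (θ / a)) (fun t x => a • v (a * t) x) t x =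
        a • (a • Torus.timeDerivWithin (Icc 0 θ) v (a * t) x) := by
      have hg : HasDerivWithinAt (fun s => v s x) (Torus.timeDerivWithin (Icc 0 θ) v (a * t) x) (Icc 0 θ)
          (a * t) := h.smooth_velocity.hasDerivWithinAt_slice hat x
      have hh : HasDerivWithinAt (fun s : ℝ => a * s) a (Icc 0 (θ / a)) t := by
        simpa using (hasDerivWithinAt_id t (Icc 0 (θ / a))).const_mul a
      have hcomp := (hg.scomp t hh hmaps).const_smul a
      exact hcomp.derivWithin (hUD t ht)
    have h2 : Torus.convect (fun x => a • v (a * t) x) (fun x => a • v (a * t) x) x =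
        a • (a • Torus.convect (v (a * t)) (v (a * t)) x) := by
      change Torus.fderiv (a • v (a * t)) x (a • v (a * t) x) = _
      rw [Torus.fderiv_const_smul (hvs.isContDiff (by simp)), FunLike.coe_smul, Pi.smul_apply, map_smul]
      rfl
    have h3 : Torus.gradient (fun x => a ^ 2 * q (a * t) x) x = a ^ 2 • Torus.gradient (q (a * t)) x := by
      change Torus.gradient (a ^ 2 • q (a * t)) x = _
      exact Torus.gradient_const_smul (hqs.isContDiff (by simp)) _ _
    have h4 : Torus.laplacian (fun x => a • v (a * t) x) x = a • Torus.laplacian (v (a * t)) x := by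
      change Torus.laplacian (a • v (a * t)) x = _
      exact Torus.laplacian_const_smul_apply hvs a x
    have hm := h.momentum (a * t) hat x
    have e1 : a * μ * a = a * a * μ := by ring
    rw [h1, h2, h3, h4, smul_smul, smul_smul, ← smul_add, hm, smul_add, smul_sub, smul_smul, smul_smul, e1,
      pow_two, Pi.smul_apply]
  · have hat : a * t ∈ Icc 0 θ := hmaps ht
    have hvs : Torus.IsSmooth (v (a * t)) := h.smooth_velocity.isSmooth_slice hat
    change Torus.divergence (a • v (a * t)) x = 0
    rw [Torus.divergence_const_smul (hvs.isContDiff (by simp)), h.divFree (a * t) hat x, mul_zero]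

/-! ### The main theorem -/

/-- **Local classical solutions of the forced Navier–Stokes system on `T^d` from the zero datum** (the
short-time smooth theory, Majda–Bertozzi 2002, Thm. 3.4, for a steady smooth mean-zero force).  For `ν > 0`
and a smooth mean-zero `f : T^d → ℝ^d` there are `T > 0` and a classical solution `(u, p)` of
`∂ₜu + (u·∇)u = νΔu − ∇p + f`, `div u = 0` on `[0, T] × T^d` with `u(0) = 0` and mean-zero velocity and
pressure slices.  Proof: the unit-viscosity solution for the force `ν⁻² f`
(`Torus.exists_classicalNS_forced_zero_datum_one`) rescaled by `(u, p)(t, x) = (ν v(νt, x), ν² q(νt, x))`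
(`Torus.IsClassicalNSSolutionOn.viscosity_rescale_Icc`). [cite: MajdaBertozziCUP2002, Thm. 3.4] -/
theorem Torus.exists_classicalNS_forced_zero_datum [Nonempty d] {ν : ℝ} (hν : 0 < ν)
    {f : UnitAddTorus d → EuclideanSpace ℝ d} (hf : Torus.IsSmooth f) (hfm : Torus.HasZeroMean f) :
    ∃ T : ℝ, 0 < T ∧ ∃ (u : ℝ → UnitAddTorus d → EuclideanSpace ℝ d) (p : ℝ → UnitAddTorus d → ℝ),
      Torus.IsClassicalNSSolutionOn (Icc 0 T) ν (fun _ => f) u p ∧ u 0 = 0 ∧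
      (∀ t ∈ Icc 0 T, Torus.HasZeroMean (u t)) ∧ ∀ t ∈ Icc 0 T, Torus.HasZeroMean (p t) := by
  -- unit viscosity for the force `ν⁻² f`
  have hf₁ : Torus.IsSmooth ((ν ^ 2)⁻¹ • f) := hf.smul _
  have hf₁m : Torus.HasZeroMean ((ν ^ 2)⁻¹ • f) := by
    show ∫ x, ((ν ^ 2)⁻¹ • f) x = 0
    simp only [Pi.smul_apply, integral_smul, show ∫ x, f x = 0 from hfm, smul_zero]
  obtain ⟨θ, hθ, v, q, hsol, hv0, hvm, hqm⟩ := Torus.exists_classicalNS_forced_zero_datum_one hf₁ hf₁m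
  have hmaps : MapsTo (fun t : ℝ => ν * t) (Icc 0 (θ / ν)) (Icc 0 θ) := fun t ht =>
    ⟨mul_nonneg hν.le ht.1, by rw [← mul_div_cancel₀ θ hν.ne']; exact mul_le_mul_of_nonneg_left ht.2 hν.le⟩
  have hres := hsol.viscosity_rescale_Icc hν hθ
  have hforce : ν ^ 2 • ((ν ^ 2)⁻¹ • f) = f := by
    rw [smul_smul, mul_inv_cancel₀ (pow_ne_zero 2 hν.ne'), one_smul]
  rw [mul_one, hforce] at hres
  refine ⟨θ / ν, div_pos hθ hν, _, _, hres, ?_, fun t ht => ?_, fun t ht => ?_⟩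
  · funext x
    simp only [mul_zero, hv0, Pi.zero_apply, smul_zero]
  · show ∫ x, ν • v (ν * t) x = 0
    rw [integral_smul, show ∫ x, v (ν * t) x = 0 from hvm _ (hmaps ht), smul_zero]
  · show ∫ x, ν ^ 2 * q (ν * t) x = 0
    rw [integral_const_mul, show ∫ x, q (ν * t) x = 0 from hqm _ (hmaps ht), mul_zero]

end Literature.Analysis.FluidPDE

end
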